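import Literature.MathematicalPhysics.QuantumFieldTheory.Balaban1983to89.Node00.TwoRunSiteComponentSize
import Literature.Combinatorics.SimpleGraph.ConnectedSubsetsOfGivenSize
import Mathlib.Data.Fintype.BigOperators

/-!
# NODE 00 — THE PEIERLS COVER OF THE COMPONENT-SIZE READING: a big component of the large-field region at a level forces one of at most
# `|sites| · (3^d)^{2(m−1)}` explicit connected `m`-sets of finest sites to be ENTIRELY large-field (the ENTROPY side of the per-level letter)

Cell `pub-ymgap`, YM-PLAN Track A (HUMAN RULING D-0062; width push D-0149); seat `pub-ymgap-dag-n20-d` (R134 (a) N20 NE7b s3) gen 32 — continuation of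
`Node00/TwoRunSiteComponentSize` (p701796: `compIn ∕ HasBigComponent ∕ KeyBigOldComponent ∕ bigOfCard`) with the general graph lemmas of
`Literature/Combinatorics/SimpleGraph/ConnectedSetsThroughVertexCount` (p706465: connected `m`-sets through a vertex `≤ Δ^{2(m−1)}`) and
`…/ConnectedSubsetsOfGivenSize` (connected induced subsets of every size; the covering step).  [LF-II] = [Balaban1989LargeFieldII].

WHY.  At the component-size reading the per-level letter of `Summits/…/BalabanUVNodesSpineReadingOfRecord13CoPHKComponentSizeLevels` (p704298) is «the weight
fraction of the keys whose level-`j` large-field region `Z_j` has a component of `≥ m` finest sites».  A Peierls estimate of it is ENTROPY × ENERGY: (entropy) the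
event is covered by the events «`S ⊆ Z_j`», `S` ranging over the connected `m`-sets of sites through some site — at most `|sites| · Δ^{2(m−1)}` of them on a graph of
degree `≤ Δ`; (energy) each event «`S ⊆ Z_j`» should carry a factor `exp(−O(1) p₀(g_j)² · m)` under the dressed densities ([LF-II] (1.79) p.383, (1.89) p.387 — per
large-field cube).  This file types the ENTROPY side completely for the torus key (site-level touching `SiteTouch`, degree `≤ 3^d`); the ENERGY side is NE7b's analytic
content and is NOT typed here.
WHAT IS TYPED.  §1 `touchingGraph τ := SimpleGraph.fromRel τ` (the simple graph of a touching relation: `a ∼ b` iff `a ≠ b` and they touch either way); a touching chain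
inside `S` from `z` is a walk of `touchingGraph τ` inside the COMPONENT `compIn τ S z` (`reachable_induce_compIn_of_connIn`), so ★ `connected_induce_compIn`: the graph
induced on a component is connected.  §2 ★ `exists_connected_finset_of_hasBigComponent` (finite `α`): `HasBigComponent τ (bigOfCard m j) Z` with `1 ≤ m j` ⇒ some
`z ∈ Z` and some finset `S ∋ z`, `S ⊆ Z`, `S.card = m j`, `touchingGraph τ` connected on `S` — by the Combinatorics lemma `exists_connected_subset_card_eq_of_le`; ★★
`setOf_hasBigComponent_subset_iUnion` (the cover as an inclusion of events) and `ncard_touchAnimals_le_pow` (per site at most `Δ^{2(m−1)}` such `S` when degrees `≤ Δ`,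
the Combinatorics count BY NAME).  §3 the torus: `degree_touchingGraph_siteTouch_le` (every site of `Site P j = Fin d → ZMod (sitesPerDir j)` touches at most `3^d` others:
the neighbours are among the translates `z + δ`, `δ ∈ {0, 1, −1}^d`), hence ★★ `ncard_siteTouchAnimals_le_pow` (`≤ (3^d)^{2(m−1)}` connected `m`-sets of sites through a
site) and ★★ `exists_siteTouchAnimal_of_hasBigComponent` (the cover on the torus).
HONEST — WHAT THIS IS NOT.  Pure combinatorics over the key layer; NO weight, NO measure, NO estimate; the energy factor is NOT typed and NOT claimed; nothing of Bałaban's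
asserted; NE7 ∕ NE7b ∕ NE7c NOT PRINTED for `d = 4` and NOT proved; no node count moves (typed 28∕28 · discharged 8∕27); no `sorry`, no `axiom`, no `instance` (decidability of
the touching graph's adjacency enters as an instance HYPOTHESIS where a `degree` is mentioned), no `notation`; one finite four-torus programme at fixed `ε` — NOT ℝ⁴, NOT OS,
NOT a mass gap, NOT the Clay problem.
-/

noncomputable section

namespace Literature.MathematicalPhysics.QuantumFieldTheory.Balaban1983to89.Node00

open T4Continuum B14.Eq213MaximalDomains B15Eq112TorusCover B14DomainGeom B14.Eq218Concrete

/-! ## §1  The touching graph; components are connected in it -/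

section Graph

variable {α : Type*} (τ : α → α → Prop)

/-- **THE TOUCHING GRAPH** of a relation `τ`: distinct points adjacent iff they touch (in either order).  (Named `touchingGraph` to stay clear of
`B16MergeGeometry.touchGraph`, the touching graph of an indexed family of point sets.) [cite: Balaban1989LargeFieldII, (1.84) p.386 (bookkeeping)] -/
def touchingGraph : _root_.SimpleGraph α :=
  _root_.SimpleGraph.fromRel τ

/-- Adjacency, unfolded. [cite: Balaban1989LargeFieldII, (1.84) p.386 (bookkeeping)] -/
theorem touchingGraph_adj (a b : α) : (touchingGraph τ).Adj a b ↔ a ≠ b ∧ (τ a b ∨ τ b a) :=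
  _root_.SimpleGraph.fromRel_adj τ a b

/-- A touching chain inside `S` from `z ∈ S` to `z′` is a walk of the touching graph INSIDE THE COMPONENT `compIn τ S z` (every intermediate point is reachable from `z`,
hence in the component). [cite: Balaban1989LargeFieldII, (1.84) p.386 (bookkeeping)] -/
theorem reachable_induce_compIn_of_connIn {S : Set α} {z z' : α} (h : ConnIn τ S z z') :
    ((touchingGraph τ).induce (compIn τ S z)).Reachable ⟨z, mem_compIn_self τ S z⟩ ⟨z', h⟩ := by
  induction h with
  | refl => exact _root_.SimpleGraph.Reachable.refl _
  | tail hab hbc ih =>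
    rename_i b c
    by_cases hbc' : b = c
    · subst hbc'
      exact ih
    · refine ih.trans (_root_.SimpleGraph.Adj.reachable ?_)
      rw [_root_.SimpleGraph.induce_adj, touchingGraph_adj]
      exact ⟨hbc', Or.inl hbc.2.2⟩

/-- ★ **THE TOUCHING GRAPH INDUCED ON A COMPONENT IS CONNECTED**. [cite: Balaban1989LargeFieldII, (1.84) p.386 (bookkeeping)] -/
theorem connected_induce_compIn (S : Set α) (z : α) : ((touchingGraph τ).induce (compIn τ S z)).Connected := by
  rw [_root_.SimpleGraph.connected_iff_exists_forall_reachable]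
  exact ⟨⟨z, mem_compIn_self τ S z⟩, fun w => reachable_induce_compIn_of_connIn τ w.2⟩

end Graph

/-! ## §2  The cover: a big component contains a connected `m`-set through one of its points -/

section Cover

variable {α : Type*} [Fintype α] [DecidableEq α] (τ : α → α → Prop)

/-- ★ **A BIG COMPONENT CONTAINS A CONNECTED `m`-ANIMAL**: if `Z` has a component (for `τ`) with at least `m j ≥ 1` points, then some `z ∈ Z` and some finset `S ∋ z` with
`S ⊆ Z`, `S.card = m j` and `touchingGraph τ` connected on `S` exist (`Literature.Combinatorics.SimpleGraph.exists_connected_subset_card_eq_of_le` applied inside the component).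
[cite: Balaban1989LargeFieldII, (1.80) p.384 (bookkeeping)] -/
theorem exists_connected_finset_of_hasBigComponent {m : ℕ → ℕ} {j : ℕ} (h1 : 1 ≤ m j) {Z : Set α} (h : HasBigComponent τ (bigOfCard m j) Z) :
    ∃ z ∈ Z, ∃ S : Finset α, (S : Set α) ⊆ Z ∧ z ∈ S ∧ S.card = m j ∧ ((touchingGraph τ).induce (S : Set α)).Connected := by
  classical
  obtain ⟨z, hz, hbig⟩ := h
  set T : Finset α := (compIn τ Z z).toFinset with hT
  have hTset : (T : Set α) = compIn τ Z z := by rw [hT, Set.coe_toFinset]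
  have hTZ : (T : Set α) ⊆ Z := by
    rw [hTset]
    exact compIn_subset τ hz
  have hzT : z ∈ T := by
    rw [hT, Set.mem_toFinset]
    exact mem_compIn_self τ Z z
  have hTconn : ((touchingGraph τ).induce (T : Set α)).Connected := by
    rw [hTset]
    exact connected_induce_compIn τ Z z
  have hm : m j ≤ T.card := by
    have hb : m j ≤ (compIn τ Z z).ncard := hbig
    rwa [Set.ncard_eq_toFinset_card' (compIn τ Z z), ← hT] at hb
  obtain ⟨S, hST, hzS, hS, hSc⟩ :=
    Literature.Combinatorics.SimpleGraph.exists_connected_subset_card_eq_of_le (touchingGraph τ) (Finset.Subset.refl T) hTconn hzT h1 hm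
  exact ⟨z, hz, S, (Finset.coe_subset.2 hST).trans hTZ, hzS, hS, hSc⟩

/-- ★★ **THE PEIERLS COVER AS AN INCLUSION OF EVENTS**: «`Z` has a component of `≥ m j` points» ⊆ ⋃ over the points `z` and the connected `(m j)`-sets `S ∋ z` of «`S ⊆ Z`».
[cite: Balaban1989LargeFieldII, (1.80) p.384 (bookkeeping)] -/
theorem setOf_hasBigComponent_subset_iUnion {m : ℕ → ℕ} {j : ℕ} (h1 : 1 ≤ m j) :
    {Z : Set α | HasBigComponent τ (bigOfCard m j) Z} ⊆
      ⋃ z : α, ⋃ S ∈ {S : Finset α | z ∈ S ∧ S.card = m j ∧ ((touchingGraph τ).induce (S : Set α)).Connected}, {Z : Set α | (S : Set α) ⊆ Z} := by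
  intro Z hZ
  obtain ⟨z, -, S, hSZ, hzS, hS, hSc⟩ := exists_connected_finset_of_hasBigComponent τ h1 hZ
  simp only [Set.mem_iUnion, Set.mem_setOf_eq, exists_prop]
  exact ⟨z, S, ⟨hzS, hS, hSc⟩, hSZ⟩

/-- **THE ENTROPY COUNT PER POINT** (degrees of the touching graph `≤ Δ`; `Literature.Combinatorics.SimpleGraph.ncard_connected_finsets_through_le_pow` BY NAME): at most
`Δ^{2(n−1)}` connected `n`-sets through a point. [cite: Balaban1989LargeFieldII, (1.80) p.384 (bookkeeping)] -/
theorem ncard_touchAnimals_le_pow [DecidableRel (touchingGraph τ).Adj] {Δ : ℕ} (hΔ : ∀ a, (touchingGraph τ).degree a ≤ Δ) (z : α) (n : ℕ) :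
    {S : Finset α | z ∈ S ∧ S.card = n ∧ ((touchingGraph τ).induce (S : Set α)).Connected}.ncard ≤ Δ ^ (2 * (n - 1)) :=
  Literature.Combinatorics.SimpleGraph.ncard_connected_finsets_through_le_pow (touchingGraph τ) hΔ z n

end Cover

/-! ## §3  The torus: site-level touching has degree at most `3^d` -/

section Torus

variable {P : Params} {j : ℕ}

/-- The three admissible coordinate differences. [cite: Balaban1989LargeFieldII, (1.84) p.386 (bookkeeping)] -/
theorem siteTouch_sub_mem (z z' : Site P j) (h : SiteTouch z z') (μ : Fin P.d) :
    (z' - z) μ ∈ ({0, 1, -1} : Finset (ZMod (P.sitesPerDir j))) := by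
  have hsub : (z' - z) μ = z' μ - z μ := rfl
  rw [hsub]
  rcases h μ with h0 | h1 | h2
  · rw [h0]; simp
  · rw [h1]; simp
  · rw [h2]; simp

/-- … and in the reverse order (negatives of admissible differences are admissible). [cite: Balaban1989LargeFieldII, (1.84) p.386 (bookkeeping)] -/
theorem siteTouch_sub_mem' (z z' : Site P j) (h : SiteTouch z' z) (μ : Fin P.d) :
    (z' - z) μ ∈ ({0, 1, -1} : Finset (ZMod (P.sitesPerDir j))) :=
  siteTouch_sub_mem z z' h.symm μ

/-- ★ **EVERY SITE TOUCHES AT MOST `3^d` OTHERS**: the neighbours of `z` in the touching graph are among the translates `z + δ`, `δ ∈ {0, 1, −1}^d`.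
[cite: Balaban1989LargeFieldII, (1.84) p.386 (bookkeeping)] -/
theorem degree_touchingGraph_siteTouch_le [DecidableRel (touchingGraph (SiteTouch (P := P) (j := j))).Adj] (z : Site P j) :
    (touchingGraph (SiteTouch (P := P) (j := j))).degree z ≤ 3 ^ P.d := by
  classical
  set D : Finset (Site P j) :=
    (Fintype.piFinset fun _ : Fin P.d => ({0, 1, -1} : Finset (ZMod (P.sitesPerDir j)))).image fun δ => z + δ with hD
  have hsub : (touchingGraph (SiteTouch (P := P) (j := j))).neighborFinset z ⊆ D := by
    intro z' hz'
    rw [_root_.SimpleGraph.mem_neighborFinset, touchingGraph_adj] at hz'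
    rw [hD, Finset.mem_image]
    refine ⟨z' - z, Fintype.mem_piFinset.2 fun μ => ?_, add_sub_cancel z z'⟩
    rcases hz'.2 with h | h
    · exact siteTouch_sub_mem z z' h μ
    · exact siteTouch_sub_mem' z z' h μ
  calc (touchingGraph (SiteTouch (P := P) (j := j))).degree z
      = ((touchingGraph (SiteTouch (P := P) (j := j))).neighborFinset z).card := (_root_.SimpleGraph.card_neighborFinset_eq_degree _ z).symm
    _ ≤ D.card := Finset.card_le_card hsub
    _ ≤ (Fintype.piFinset fun _ : Fin P.d => ({0, 1, -1} : Finset (ZMod (P.sitesPerDir j)))).card := Finset.card_image_le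
    _ = ∏ _μ : Fin P.d, ({0, 1, -1} : Finset (ZMod (P.sitesPerDir j))).card := Fintype.card_piFinset _
    _ ≤ 3 ^ P.d := by
        calc ∏ _μ : Fin P.d, ({0, 1, -1} : Finset (ZMod (P.sitesPerDir j))).card
            ≤ 3 ^ (Finset.univ : Finset (Fin P.d)).card := Finset.prod_le_pow_card _ _ 3 fun _ _ => Finset.card_le_three
          _ = 3 ^ P.d := by rw [Finset.card_univ, Fintype.card_fin]

/-- ★★ **AT MOST `(3^d)^{2(n−1)}` CONNECTED `n`-SETS OF SITES THROUGH A SITE** (site-level touching). [cite: Balaban1989LargeFieldII, (1.80) p.384 (bookkeeping)] -/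
theorem ncard_siteTouchAnimals_le_pow [DecidableRel (touchingGraph (SiteTouch (P := P) (j := j))).Adj] (z : Site P j) (n : ℕ) :
    {S : Finset (Site P j) | z ∈ S ∧ S.card = n ∧ ((touchingGraph (SiteTouch (P := P) (j := j))).induce (S : Set (Site P j))).Connected}.ncard ≤
      (3 ^ P.d) ^ (2 * (n - 1)) :=
  ncard_touchAnimals_le_pow SiteTouch (degree_touchingGraph_siteTouch_le) z n

/-- ★★ **THE PEIERLS COVER ON THE TORUS**: a large-field region `Z` (a set of sites) with a component of at least `m j ≥ 1` sites contains, through one of its sites, a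
connected set of EXACTLY `m j` sites — one of the `≤ (3^d)^{2(m j − 1)}` candidates through that site. [cite: Balaban1989LargeFieldII, (1.80) p.384 (bookkeeping)] -/
theorem exists_siteTouchAnimal_of_hasBigComponent {m : ℕ → ℕ} {lvl : ℕ} (h1 : 1 ≤ m lvl) {Z : Set (Site P j)}
    (h : HasBigComponent SiteTouch (bigOfCard m lvl) Z) :
    ∃ z ∈ Z, ∃ S : Finset (Site P j), (S : Set (Site P j)) ⊆ Z ∧ z ∈ S ∧ S.card = m lvl ∧
      ((touchingGraph (SiteTouch (P := P) (j := j))).induce (S : Set (Site P j))).Connected := by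
  classical
  exact exists_connected_finset_of_hasBigComponent SiteTouch h1 h

end Torus

end Literature.MathematicalPhysics.QuantumFieldTheory.Balaban1983to89.Node00

end
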